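import Literature.MathematicalPhysics.QuantumFieldTheory.Balaban1983to89.B9Eq326LocalPartKatoForm

/-!
# `Balaban1983to89.B9Eq326LocalPartSliceEquation` — T. Bałaban, *Propagators for lattice gauge theories in a background field*, Commun. Math. Phys. **99** (1985)
# 389–434 [Balaban1985BackgroundPropagators] (3.26) p. 395 (the local part `A₀ = Δ(U) + D_UD*_U + aQ*Q` of `Δ_a`), (3.23) p. 394, with [Balaban1985Variational]
# (134)–(135) p. 298: **THE KATO PART OF `A₀` IS THE SITE LAPLACIAN (3.23) ON EACH μ-SLICE OF A BOND FIELD, SO `A₀u = f` IS, SLICE BY SLICE, A PLAIN-RESOLVENT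
# EQUATION `(Δ_U + m)u_μ + p_μ = f_μ` WITH THE ORDER-ZERO PART AND THE FREE COMPARISON MASS IN THE DATA TERM `p_μ = ((A₀ − L_K)u)_μ − m·u_μ` — the input shape of
# `B9Eq342GradientRowAssembly` §5 (storey J's gradient row, «the penalty is a data term») for the OWNER's plan v11 §2 (ii)**

statement-level skeleton of published theorems with citation tags; proofs where landed; nothing here is a claim about the Yang–Mills mass gap

CITATION HEADER (lean-in-tree rule).  Audit cell `pub-balaban`, sub-cell `t4`, BINDER row NE9; filed by NE9 crux-team LEAF PROVER 05
(`b2b-balaban-t4-ne9-formalise-leaf-05`, gen 84).  SOURCE READ first-hand [Balaban1985BackgroundPropagators] p. 395 (3.26), p. 394 (3.23); [Balaban1985Variational]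
p. 298 (134)–(135) (quoted in `B11Eq135WeitzenbockCarrier`).  The OWNER lineage t4-ne9-p1 g92's `B9Eq326LocalPartKatoForm` (`bondLapK`, `localPart_eq_kato_add`,
`kato_form_localPart`) is the object read; [folklore] unfolding + one rearrangement; nothing printed is a hypothesis.

WHAT IS PROVED (sorry-free; 0 `def`; [folklore]).  Generic `RCLike 𝕜`, transporter data `R S`, `c : 𝕜`; the μ-slice of a bond field `u` is written out as
`(WL2.equiv).symm (fun y => WL2.equiv u (y, μ))` (no definition).
* §1 **`equiv_bondLapK_slice`** — `(L_K u)(x, μ) = (Δ^{site}_{R,S} u(·, μ))(x)` (`bondLapK` = `covBondLap` read on `BondL2K`, and `covBondLap` IS `covDiv ∘ covDeriv` on the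
  slice: `rfl`).
* §2 **`slice_equation`** — `L_K u + P u = f` (any linear `P`: the OWNER's `Q†(a•Q) + (Δ′ − η⁻²𝒦)` by `localPart_eq_kato_add`) ⟹ for every `μ` and every `m`:
  `Δ^{site}(u_μ) + m•u_μ + p_μ = f_μ` in `SiteL2K`, `p_μ := (Pu)_μ − m•u_μ` — EXACTLY the hypothesis `hu` of `B9Eq342GradientRowAssembly.norm_covDeriv_le_weighted_of_letters_penalty`
  with `h := f_μ`, `p := p_μ`; **`norm_slice_data_le`** — its weighted value letter: `‖(Pu)(y,μ)‖ ≤ N_P·W(y)` and `‖u(y,μ)‖ ≤ N_u·W(y)` ⟹ `‖p_μ(y)‖ ≤ (N_P + |m|·N_u)·W(y)`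
  (for real `m` read in `𝕜`).
HONEST SCOPE.  Glue only: the gradient row of `A₀⁻¹` then follows slice by slice from `B9Eq342GradientRowAssembly` §5 GIVEN its displayed letters (the (3.35) cube
letters, the cutoffs, the weighted value rows of `u = A₀⁻¹f` and of `Pu`); none is supplied here; nothing of [B9] Thm 3.1 ∕ 3.3 asserted, valued or discharged.  NOT
summit progress (cell pub-balaban: NE9 NOT PRINTED ∕ NOT PROVED; «NE9 ⇐ the named binders»; row WALLED ON A MODEL (O-NE9-1; #5 UNRULED); spine PROVED 0∕9; rung (B)+1
finite T⁴ — NOT infinite volume, NOT mass gap, NOT BetaPertH, NOT Clay).  HONEST DEPENDENCY (cell line): continuum YM on T⁴ ⇐ BetaPertH ∧ nine spine estimates (0/9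
proved); BetaPertH ⇐ (D1) ∧ (D4) ∧ CAP+tail; G-an2-4 gates asym, D1 and NE2/3/4.  NEW file importing `B9Eq326LocalPartKatoForm` only; nothing modified.  Net new
unproved facts: 0.
-/

noncomputable section

namespace Literature.MathematicalPhysics.QuantumFieldTheory.Balaban1983to89.B9Eq326LocalPartSliceEquation

open B4Sect5Torus (TSite)
open B9SectCLatticeCarrier (Bond)
open B9Eq311L2Pairing (WL2)
open B11Eq103H1Complex (SiteL2K BondL2K covLaplaceSiteK)
open B11Eq135WeitzenbockCarrier (covBondLap)
open B9Eq326LocalPartKatoForm (bondLapK equiv_bondLapK)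

variable {𝕜 : Type*} [RCLike 𝕜] {d : ℕ} {Pd : Fin d → ℕ} {W : Type*} [NormedAddCommGroup W] [InnerProductSpace 𝕜 W] {c₀ : ℝ} [Fact (0 < c₀)]

/-! ## §1 The Kato part of `A₀` on a slice -/

/-- **`(L_K u)(x, μ) = (Δ^{site} u_μ)(x)`** — the covariant bond Laplacian of [B11] (135) in Kato form, read at the bond `(x, μ)`, is the covariant SITE
Laplacian (3.23) of the μ-slice `u_μ = u(·, μ)` at `x` (same transporters); `rfl` through the identifications. [folklore]
[cite: Balaban1985BackgroundPropagators, (3.23) p.394, (3.26) p.395; Balaban1985Variational, (135) p.298] -/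
theorem equiv_bondLapK_slice (c : 𝕜) (R S : Bond d Pd → W →ₗ[𝕜] W) (u : BondL2K 𝕜 d Pd c₀ W) (x : TSite d Pd) (μ : Fin d) :
    WL2.equiv 𝕜 _ W (bondLapK 𝕜 c₀ c R S u) (x, μ) =
      WL2.equiv 𝕜 _ W (covLaplaceSiteK (c₀ := c₀) c R S ((WL2.equiv 𝕜 (fun _ : TSite d Pd => c₀) W).symm fun y => WL2.equiv 𝕜 _ W u (y, μ))) x := rfl

/-! ## §2 The slice equation with a free comparison mass -/

/-- **THE SLICE EQUATION.**  If `L_K u + P u = f` for some linear `P` on bond fields (the OWNER's `A₀ = L_K + [Q†(a•Q) + (Δ′ − η⁻²𝒦)]`,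
`B9Eq326LocalPartKatoForm.localPart_eq_kato_add`), then for every direction `μ` and every `m : 𝕜` the slice `u_μ` solves
`Δ^{site}u_μ + m•u_μ + p_μ = f_μ` with `p_μ = (Pu)_μ − m•u_μ` — the `hu` hypothesis of `B9Eq342GradientRowAssembly.norm_covDeriv_le_weighted_of_letters_penalty`. [folklore]
[cite: Balaban1985BackgroundPropagators, (3.26) p.395, (3.23) p.394] -/
theorem slice_equation (c : 𝕜) (R S : Bond d Pd → W →ₗ[𝕜] W) (P : BondL2K 𝕜 d Pd c₀ W →ₗ[𝕜] BondL2K 𝕜 d Pd c₀ W) (u f : BondL2K 𝕜 d Pd c₀ W)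
    (hu : bondLapK 𝕜 c₀ c R S u + P u = f) (m : 𝕜) (μ : Fin d) :
    covLaplaceSiteK (c₀ := c₀) c R S ((WL2.equiv 𝕜 (fun _ : TSite d Pd => c₀) W).symm fun y => WL2.equiv 𝕜 _ W u (y, μ)) +
        m • (WL2.equiv 𝕜 (fun _ : TSite d Pd => c₀) W).symm (fun y => WL2.equiv 𝕜 _ W u (y, μ)) +
        (WL2.equiv 𝕜 (fun _ : TSite d Pd => c₀) W).symm (fun y => WL2.equiv 𝕜 _ W (P u) (y, μ) - m • WL2.equiv 𝕜 _ W u (y, μ)) =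
      (WL2.equiv 𝕜 (fun _ : TSite d Pd => c₀) W).symm fun y => WL2.equiv 𝕜 _ W f (y, μ) := by
  apply (WL2.equiv 𝕜 (fun _ : TSite d Pd => c₀) W).injective
  funext y
  have hb : WL2.equiv 𝕜 _ W (bondLapK 𝕜 c₀ c R S u) (y, μ) + WL2.equiv 𝕜 _ W (P u) (y, μ) = WL2.equiv 𝕜 _ W f (y, μ) := by
    rw [← hu, WL2.equiv_add, Pi.add_apply]
  rw [WL2.equiv_add, WL2.equiv_add, WL2.equiv_smul, Pi.add_apply, Pi.add_apply, Pi.smul_apply, Equiv.apply_symm_apply, Equiv.apply_symm_apply,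
    Equiv.apply_symm_apply, ← equiv_bondLapK_slice, ← hb]
  abel

/-- **THE WEIGHTED VALUE LETTER OF THE SLICE DATA TERM**: `‖(Pu)(y, μ)‖ ≤ N_P·W(y)` and `‖u(y, μ)‖ ≤ N_u·W(y)` ⟹ `‖(Pu)(y,μ) − m•u(y,μ)‖ ≤ (N_P + ‖m‖·N_u)·W(y)` —
the `hp` letter of `B9Eq342GradientRowAssembly` §5 (`W` any weight, e.g. the product-`cosh` weight). [folklore]
[cite: Balaban1985BackgroundPropagators, (3.26) p.395] -/
theorem norm_slice_data_le {X : Type*} (Pu u : X → W) (Wt : X → ℝ) {NP Nu : ℝ} (m : 𝕜)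
    (hP : ∀ y, ‖Pu y‖ ≤ NP * Wt y) (hu : ∀ y, ‖u y‖ ≤ Nu * Wt y) (y : X) :
    ‖Pu y - m • u y‖ ≤ (NP + ‖m‖ * Nu) * Wt y := by
  calc ‖Pu y - m • u y‖ ≤ ‖Pu y‖ + ‖m • u y‖ := norm_sub_le _ _
    _ ≤ NP * Wt y + ‖m‖ * (Nu * Wt y) := by
        rw [norm_smul]; exact add_le_add (hP y) (mul_le_mul_of_nonneg_left (hu y) (norm_nonneg _))
    _ = (NP + ‖m‖ * Nu) * Wt y := by ring

end Literature.MathematicalPhysics.QuantumFieldTheory.Balaban1983to89.B9Eq326LocalPartSliceEquation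

end
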